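import Literature.LinearAlgebra.Matrix.CubicCharpolyDiscrNonRegular   -- ★ p852036: `exists_vecMulVec_of_mul_self_eq_zero`, `vecMulVec_mul_vecMulVec_self`
import HarnessLib

/-!
# The quasi-split `σ`-hermitian form `J₃ = antidiag(1,1,1)` in three variables: explicit unitary elements (torus, `J₃`, Heisenberg), the Lie algebra
# membership of `c·E₀₂`, `c·E₂₀`, diagonal matrices, and WITT'S THEOREM FOR THE MINIMAL NILPOTENT ORBIT — every non-zero square-zero `X` with
# `(X.map σ)ᵀ J₃ + J₃ X = 0` is conjugate UNDER THE UNITARY GROUP to some `c·E₀₂` with `σ c = −c`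

Topic `LinearAlgebra/Matrix`; namespace `Literature.LinearAlgebra.Matrix.UnitaryThreeWitt`.  THEOREMS ONLY (no definition, no instance, no notation, no named fact,
no `sorry`).  Brick (D4d-E) «UNITARY CLAUSES + WITT» of the `hodgecm-mathlib` cell's ROAD «HC-D» (crux H413 = `stmt-HodgeConjecture-24833`; dealer F0P2-p01 (g23); count-neutral):
the companion of ★ `MinimalNilpotentSliceFinThree` (the Slodowy data at the MODEL `N = c·E₀₂`) — this file moves EVERY minimal nilpotent of the unitary Lie algebra to
the model by a unitary conjugation, so the analytic brick D5(iii) («`|η|^{−1∕2}` is integrable near a minimal nilpotent») may work at the model only.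

SETTING (generic, as in ★ `CubicChevalleyDifferentialSkewHermitian`): `E` a field, `σ : E →+* E` an involutive ring endomorphism (`F = E^σ`; no `2⁻¹` is needed
anywhere), `J₃ = !![0,0,1; 0,1,0; 1,0,0]` — the tree's quasi-split form `Matrix.of fun i j : Fin 3 => if i.val + j.val + 1 = 3 then 1 else 0` (`antidiagonal_three_eq`);
UNITARY: `(g.map σ)ᵀ * J₃ * g = J₃` (the range letter `hρr` of ★ C4u `F0P3cStCharTSCayleyChartUnitary` with `x = 1`); LIE ALGEBRA: `(X.map σ)ᵀ * J₃ + J₃ * X = 0` (`hιr`);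
the hermitian form is written `vecMul (σ ∘ u) J₃ ⬝ᵥ v = σ u₀ · v₂ + σ u₁ · v₁ + σ u₂ · v₀`.

* §0 `J₃`: `antidiagonal_three_eq` (bridge to the tree token), `antidiagonal_three_mul_self` (`J₃² = 1`), `antidiagonal_three_map_transpose` (`σ`-hermitian),
  `form_apply` (the explicit form), `sigma_vecMul_antidiagonal_three` (`σ (ᵗ(σu) J₃)ᵢ = (J₃ u)ᵢ`).
* §1 UNITARY ELEMENTS: `unitary_mul`, `inv_eq_of_unitary` (`g⁻¹ = J₃ (g.map σ)ᵀ J₃`), `isUnit_det_of_unitary`, `diagonal_unitary` (`diag(a, b, (σa)⁻¹)`, `σb·b = 1`),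
  **`torus_unitary`** (`diag(t, 1, t⁻¹)`, `σ t = t` — the contracting torus of ★ `MinimalNilpotentSliceFinThree` §5 lies in `U(J₃)(F)`), `antidiagonal_three_unitary`,
  **`heisenberg_unitary`** (`n(x,y) = !![1,x,y; 0,1,−σx; 0,0,1]` with `y + σ y + x·σ x = 0`).
* §2 LIE ALGEBRA MEMBERSHIP: **`single_zero_two_mem_iff`** (`c·E₀₂ ∈ 𝔲 ↔ σ c + c = 0`), `single_two_zero_mem_iff`, `diagonal_mem_iff`, `diagonal_one_zero_neg_one_mem` (the
  `𝔰𝔩₂`-triple of ★ `MinimalNilpotentSliceFinThree` §1 lies in `𝔲`), `unitary_conj_mem` (`Ad U` preserves `𝔲`).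
* §3 SQUARE-ZERO ELEMENTS OF `𝔲`: **`exists_eq_smul_vecMulVec_of_mem`** — `X ∈ 𝔲`, `X ≠ 0`, `X² = 0` ⇒ `X = c • u·ᵗ(σu)·J₃` with `u ≠ 0` ISOTROPIC, `c ≠ 0`, `σ c = −c`
  (★ `exists_vecMulVec_of_mul_self_eq_zero` + the `σ`-parity bookkeeping); converse `smul_vecMulVec_form_mem`.
* §4 WITT: **`exists_unitary_col_zero_eq`** — every non-zero isotropic `u` is the FIRST COLUMN of a unitary `g` (explicit: `diag(u₀, 1, (σu₀)⁻¹)` if `u₂ = 0`, else the Bruhat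
  element `n(u₀∕u₂, ·)·J₃·diag(u₂, 1, (σu₂)⁻¹)`), and `unitary_conj_single_zero_two` (`g (c·E₀₂) g⁻¹ = c • (g e₀)·ᵗ(σ(g e₀))·J₃`).
* §5 MAIN **`exists_unitary_conj_single_zero_two`**: `X ∈ 𝔲`, `X ≠ 0`, `X * X = 0` ⇒ `∃ g c`, `g` unitary, `σ c = −c`, `c ≠ 0`, `X = g * single 0 2 c * g⁻¹`.

## References
* [Rogawski1990] J. D. Rogawski, *Automorphic Representations of Unitary Groups in Three Variables* (1990), §1.9 p. 8 (the quasi-split unitary group in three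
  variables, its Borel subgroup `B = TN` and the Heisenberg unipotent radical), §4.4 p. 45 (`U(Φ₃)`, `Φ₃` antidiagonal). Context locators.
* [HornJohnson2013] R. A. Horn, C. R. Johnson, *Matrix Analysis*, 2nd ed. (2013), §0.4.6 (rank-one matrices), §0.9. Context locator.
* Witt's theorem for hermitian forms: [Scharlau1985HermitianForms] W. Scharlau, *Quadratic and Hermitian Forms* (1985), Ch. 7 §9 — named in prose only (not a bib
  key); the instance proved here is explicit and needs no `2⁻¹`.
-/

set_option autoImplicit false

open Matrix

namespace Literature.LinearAlgebra.Matrix.UnitaryThreeWitt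

variable {E : Type*} [Field E] (σ : E →+* E)

/-! ## §0 The form `J₃` -/

/-- Bridge to the tree's token: `(of fun i j : Fin 3 => if i+j+1 = 3 then 1 else 0) = !![0,0,1; 0,1,0; 1,0,0]`. [cite: Rogawski1990, §4.4 p. 45] -/
theorem antidiagonal_three_eq :
    (Matrix.of fun i j : Fin 3 => if i.val + j.val + 1 = 3 then (1 : E) else 0) = !![(0 : E), 0, 1; 0, 1, 0; 1, 0, 0] := by
  ext i j
  fin_cases i <;> fin_cases j <;> rfl

/-- `J₃² = 1`. [cite: Rogawski1990, §4.4 p. 45] -/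
theorem antidiagonal_three_mul_self : !![(0 : E), 0, 1; 0, 1, 0; 1, 0, 0] * !![(0 : E), 0, 1; 0, 1, 0; 1, 0, 0] = 1 := by
  ext i j
  fin_cases i <;> fin_cases j <;> simp only [Matrix.mul_apply, Fin.sum_univ_three] <;> simp

/-- `J₃` is `σ`-hermitian: `(J₃.map σ)ᵀ = J₃`. [cite: Rogawski1990, §4.4 p. 45] -/
theorem antidiagonal_three_map_transpose : ((!![(0 : E), 0, 1; 0, 1, 0; 1, 0, 0]).map σ)ᵀ = !![(0 : E), 0, 1; 0, 1, 0; 1, 0, 0] := by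
  ext i j
  fin_cases i <;> fin_cases j <;> simp

/-- `det J₃ = −1` (a unit). [cite: Rogawski1990, §4.4 p. 45] -/
theorem det_antidiagonal_three : (!![(0 : E), 0, 1; 0, 1, 0; 1, 0, 0]).det = -1 := by
  simp [Matrix.det_fin_three]

/-- The hermitian form of `J₃`: `ᵗ(σu) J₃ v = σ u₀ · v₂ + σ u₁ · v₁ + σ u₂ · v₀`. [cite: Rogawski1990, §4.4 p. 45] -/
theorem form_apply (u v : Fin 3 → E) :
    vecMul (σ ∘ u) !![(0 : E), 0, 1; 0, 1, 0; 1, 0, 0] ⬝ᵥ v = σ (u 0) * v 2 + σ (u 1) * v 1 + σ (u 2) * v 0 := by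
  simp [dotProduct, Matrix.vecMul, Fin.sum_univ_three]
  ring

/-- `ᵗ(σu) J₃` entrywise: `(ᵗ(σu) J₃) i = σ (u (2 − i))`, packaged as `σ ((ᵗ(σu) J₃) i) = (J₃ u) i` for an involutive `σ`. [cite: Rogawski1990, §4.4 p. 45] -/
theorem sigma_vecMul_antidiagonal_three (hσ : ∀ x, σ (σ x) = x) (u : Fin 3 → E) (i : Fin 3) :
    σ (vecMul (σ ∘ u) !![(0 : E), 0, 1; 0, 1, 0; 1, 0, 0] i) = (!![(0 : E), 0, 1; 0, 1, 0; 1, 0, 0] *ᵥ u) i := by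
  fin_cases i <;>
    simp [Matrix.vecMul, Matrix.mulVec, dotProduct, Fin.sum_univ_three, hσ]

/-! ## §1 Unitary elements -/

/-- Products of unitary matrices are unitary. [cite: Rogawski1990, §1.9 p. 8] -/
theorem unitary_mul {J g h : Matrix (Fin 3) (Fin 3) E} (hg : (g.map σ)ᵀ * J * g = J) (hh : (h.map σ)ᵀ * J * h = J) :
    ((g * h).map σ)ᵀ * J * (g * h) = J := by
  rw [Matrix.map_mul, Matrix.transpose_mul,
    show (h.map σ)ᵀ * (g.map σ)ᵀ * J * (g * h) = (h.map σ)ᵀ * ((g.map σ)ᵀ * J * g) * h by simp only [Matrix.mul_assoc], hg, hh]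

/-- A unitary matrix has unit determinant (indeed `σ(det g) · det g = 1`). [cite: Rogawski1990, §1.9 p. 8] -/
theorem isUnit_det_of_unitary {g : Matrix (Fin 3) (Fin 3) E} (hg : (g.map σ)ᵀ * !![(0 : E), 0, 1; 0, 1, 0; 1, 0, 0] * g = !![(0 : E), 0, 1; 0, 1, 0; 1, 0, 0]) :
    IsUnit g.det := by
  have h := congrArg Matrix.det hg
  rw [Matrix.det_mul, Matrix.det_mul, Matrix.det_transpose, det_antidiagonal_three] at h
  -- `det (g.map σ) * (-1) * det g = -1`
  have h' : g.det * (g.map σ).det = 1 := by linear_combination (-1 : E) * h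
  exact IsUnit.of_mul_eq_one _ h'

/-- The inverse of a unitary matrix: `g⁻¹ = J₃ (g.map σ)ᵀ J₃`. [cite: Rogawski1990, §1.9 p. 8] -/
theorem inv_eq_of_unitary {g : Matrix (Fin 3) (Fin 3) E} (hg : (g.map σ)ᵀ * !![(0 : E), 0, 1; 0, 1, 0; 1, 0, 0] * g = !![(0 : E), 0, 1; 0, 1, 0; 1, 0, 0]) :
    g⁻¹ = !![(0 : E), 0, 1; 0, 1, 0; 1, 0, 0] * (g.map σ)ᵀ * !![(0 : E), 0, 1; 0, 1, 0; 1, 0, 0] := by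
  refine Matrix.inv_eq_left_inv ?_
  rw [show !![(0 : E), 0, 1; 0, 1, 0; 1, 0, 0] * (g.map σ)ᵀ * !![(0 : E), 0, 1; 0, 1, 0; 1, 0, 0] * g =
      !![(0 : E), 0, 1; 0, 1, 0; 1, 0, 0] * ((g.map σ)ᵀ * !![(0 : E), 0, 1; 0, 1, 0; 1, 0, 0] * g) by simp only [Matrix.mul_assoc], hg,
    antidiagonal_three_mul_self]

/-- The diagonal unitary elements `diag(a, b, (σa)⁻¹)` with `a ≠ 0`, `σ b · b = 1`. [cite: Rogawski1990, §1.9 p. 8] -/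
theorem diagonal_unitary (hσ : ∀ x, σ (σ x) = x) {a b : E} (ha : a ≠ 0) (hb : σ b * b = 1) :
    ((diagonal ![a, b, (σ a)⁻¹]).map σ)ᵀ * !![(0 : E), 0, 1; 0, 1, 0; 1, 0, 0] * diagonal ![a, b, (σ a)⁻¹] = !![(0 : E), 0, 1; 0, 1, 0; 1, 0, 0] := by
  have hσa : σ a ≠ 0 := (map_ne_zero σ).mpr ha
  ext i j
  fin_cases i <;> fin_cases j <;> simp [Matrix.mul_apply, Matrix.diagonal_apply, hσ, hσa, ha, hb]

/-- **The contracting torus is unitary**: `diag(t, 1, t⁻¹) ∈ U(J₃)` for a `σ`-FIXED unit `t` (`t ∈ F×`). [cite: Rogawski1990, §1.9 p. 8] -/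
theorem torus_unitary (t : Eˣ) (ht : σ t = t) :
    ((diagonal ![(↑t : E), 1, ↑t⁻¹]).map σ)ᵀ * !![(0 : E), 0, 1; 0, 1, 0; 1, 0, 0] * diagonal ![(↑t : E), 1, ↑t⁻¹] = !![(0 : E), 0, 1; 0, 1, 0; 1, 0, 0] := by
  ext i j
  fin_cases i <;> fin_cases j <;> simp [Matrix.mul_apply, Matrix.diagonal_apply, ht]

/-- `J₃` itself is unitary (the long Weyl element). [cite: Rogawski1990, §1.9 p. 8] -/
theorem antidiagonal_three_unitary :
    ((!![(0 : E), 0, 1; 0, 1, 0; 1, 0, 0]).map σ)ᵀ * !![(0 : E), 0, 1; 0, 1, 0; 1, 0, 0] * !![(0 : E), 0, 1; 0, 1, 0; 1, 0, 0] =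
      !![(0 : E), 0, 1; 0, 1, 0; 1, 0, 0] := by
  rw [antidiagonal_three_map_transpose, antidiagonal_three_mul_self, Matrix.one_mul]

/-- **The Heisenberg elements are unitary**: `n(x,y) = !![1, x, y; 0, 1, −σx; 0, 0, 1]` with `y + σ y + x · σ x = 0`. [cite: Rogawski1990, §1.9 p. 8] -/
theorem heisenberg_unitary (hσ : ∀ x, σ (σ x) = x) {x y : E} (h : y + σ y + x * σ x = 0) :
    ((!![(1 : E), x, y; 0, 1, -σ x; 0, 0, 1]).map σ)ᵀ * !![(0 : E), 0, 1; 0, 1, 0; 1, 0, 0] * !![(1 : E), x, y; 0, 1, -σ x; 0, 0, 1] =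
      !![(0 : E), 0, 1; 0, 1, 0; 1, 0, 0] := by
  ext i j
  fin_cases i <;> fin_cases j <;> simp only [Matrix.mul_apply, Fin.sum_univ_three] <;> simp [hσ]
  linear_combination h

/-! ## §2 Lie algebra membership -/

/-- `c·E₀₂ ∈ 𝔲(J₃) ↔ σ c + c = 0`. [cite: Rogawski1990, §1.9 p. 8] -/
theorem single_zero_two_mem_iff (c : E) :
    ((single (0 : Fin 3) (2 : Fin 3) c).map σ)ᵀ * !![(0 : E), 0, 1; 0, 1, 0; 1, 0, 0] + !![(0 : E), 0, 1; 0, 1, 0; 1, 0, 0] * single (0 : Fin 3) (2 : Fin 3) c = 0 ↔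
      σ c + c = 0 := by
  constructor
  · intro h
    have h22 := congrFun (congrFun h 2) 2
    simp only [Matrix.add_apply, Matrix.mul_apply, Matrix.transpose_apply, Matrix.map_apply, Fin.sum_univ_three] at h22
    simpa using h22
  · intro h
    ext i j
    fin_cases i <;> fin_cases j <;> simp only [Matrix.add_apply, Matrix.mul_apply, Matrix.transpose_apply, Matrix.map_apply, Fin.sum_univ_three] <;> simp
    exact h

/-- `c·E₂₀ ∈ 𝔲(J₃) ↔ σ c + c = 0`. [cite: Rogawski1990, §1.9 p. 8] -/
theorem single_two_zero_mem_iff (c : E) :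
    ((single (2 : Fin 3) (0 : Fin 3) c).map σ)ᵀ * !![(0 : E), 0, 1; 0, 1, 0; 1, 0, 0] + !![(0 : E), 0, 1; 0, 1, 0; 1, 0, 0] * single (2 : Fin 3) (0 : Fin 3) c = 0 ↔
      σ c + c = 0 := by
  constructor
  · intro h
    have h00 := congrFun (congrFun h 0) 0
    simp only [Matrix.add_apply, Matrix.mul_apply, Matrix.transpose_apply, Matrix.map_apply, Fin.sum_univ_three] at h00
    simpa using h00
  · intro h
    ext i j
    fin_cases i <;> fin_cases j <;> simp only [Matrix.add_apply, Matrix.mul_apply, Matrix.transpose_apply, Matrix.map_apply, Fin.sum_univ_three] <;> simp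
    exact h

/-- `diag(a, b, d) ∈ 𝔲(J₃) ↔ σ a + d = 0 ∧ σ b + b = 0 ∧ σ d + a = 0`. [cite: Rogawski1990, §1.9 p. 8] -/
theorem diagonal_mem_iff (a b d : E) :
    ((diagonal ![a, b, d]).map σ)ᵀ * !![(0 : E), 0, 1; 0, 1, 0; 1, 0, 0] + !![(0 : E), 0, 1; 0, 1, 0; 1, 0, 0] * diagonal ![a, b, d] = 0 ↔
      σ a + d = 0 ∧ σ b + b = 0 ∧ σ d + a = 0 := by
  constructor
  · intro h
    have h02 := congrFun (congrFun h 0) 2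
    have h11 := congrFun (congrFun h 1) 1
    have h20 := congrFun (congrFun h 2) 0
    simp only [Matrix.add_apply, Matrix.mul_apply, Matrix.transpose_apply, Matrix.map_apply, Fin.sum_univ_three] at h02 h11 h20
    simp at h02 h11 h20
    exact ⟨h02, h11, h20⟩
  · rintro ⟨h1, h2, h3⟩
    ext i j
    fin_cases i <;> fin_cases j <;> simp only [Matrix.add_apply, Matrix.mul_apply, Matrix.transpose_apply, Matrix.map_apply, Fin.sum_univ_three] <;> simp
    · exact h1
    · exact h2
    · exact h3

/-- `H = diag(1, 0, −1) ∈ 𝔲(J₃)`. [cite: Rogawski1990, §1.9 p. 8] -/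
theorem diagonal_one_zero_neg_one_mem :
    ((diagonal ![(1 : E), 0, -1]).map σ)ᵀ * !![(0 : E), 0, 1; 0, 1, 0; 1, 0, 0] + !![(0 : E), 0, 1; 0, 1, 0; 1, 0, 0] * diagonal ![(1 : E), 0, -1] = 0 := by
  rw [diagonal_mem_iff]
  simp

/-- `Ad U(J₃)` preserves `𝔲(J₃)`: if `g` is unitary and `X ∈ 𝔲` then `g X g⁻¹ ∈ 𝔲`. [cite: Rogawski1990, §1.9 p. 8] -/
theorem unitary_conj_mem (hσ : ∀ x, σ (σ x) = x) {g X : Matrix (Fin 3) (Fin 3) E}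
    (hg : (g.map σ)ᵀ * !![(0 : E), 0, 1; 0, 1, 0; 1, 0, 0] * g = !![(0 : E), 0, 1; 0, 1, 0; 1, 0, 0])
    (hX : (X.map σ)ᵀ * !![(0 : E), 0, 1; 0, 1, 0; 1, 0, 0] + !![(0 : E), 0, 1; 0, 1, 0; 1, 0, 0] * X = 0) :
    ((g * X * g⁻¹).map σ)ᵀ * !![(0 : E), 0, 1; 0, 1, 0; 1, 0, 0] + !![(0 : E), 0, 1; 0, 1, 0; 1, 0, 0] * (g * X * g⁻¹) = 0 := by
  -- abbreviations (no definitions): `J = J₃`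
  have hJ2 := antidiagonal_three_mul_self (E := E)
  have hJJ : ∀ M : Matrix (Fin 3) (Fin 3) E, !![(0 : E), 0, 1; 0, 1, 0; 1, 0, 0] * (!![(0 : E), 0, 1; 0, 1, 0; 1, 0, 0] * M) = M := fun M => by
    rw [← Matrix.mul_assoc, hJ2, Matrix.one_mul]
  have hJσ : (!![(0 : E), 0, 1; 0, 1, 0; 1, 0, 0]).map σ = !![(0 : E), 0, 1; 0, 1, 0; 1, 0, 0] := by
    ext i j; fin_cases i <;> fin_cases j <;> simp
  have hJt : (!![(0 : E), 0, 1; 0, 1, 0; 1, 0, 0])ᵀ = !![(0 : E), 0, 1; 0, 1, 0; 1, 0, 0] := by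
    ext i j; fin_cases i <;> fin_cases j <;> simp
  have hgσσ : (g.map σ).map σ = g := by
    ext i j; simp [hσ]
  -- `(X.map σ)ᵀ = −J X J` from `hX` and `J² = 1`
  have hXt : (X.map σ)ᵀ = -(!![(0 : E), 0, 1; 0, 1, 0; 1, 0, 0] * X * !![(0 : E), 0, 1; 0, 1, 0; 1, 0, 0]) := by
    have h1 := congrArg (· * !![(0 : E), 0, 1; 0, 1, 0; 1, 0, 0]) hX
    simp only [add_mul, Matrix.mul_assoc, hJ2, Matrix.mul_one, zero_mul] at h1
    rw [← Matrix.mul_assoc] at h1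
    exact eq_neg_of_add_eq_zero_left h1
  rw [inv_eq_of_unitary σ hg, Matrix.map_mul, Matrix.map_mul, Matrix.map_mul, Matrix.map_mul, hJσ, Matrix.transpose_map, hgσσ,
    Matrix.transpose_mul, Matrix.transpose_mul, Matrix.transpose_mul, Matrix.transpose_mul, Matrix.transpose_transpose, hJt, hXt]
  simp only [Matrix.neg_mul, Matrix.mul_neg, Matrix.mul_assoc, hJJ]
  rw [neg_add_eq_zero]

/-! ## §3 Square-zero elements of `𝔲(J₃)` -/

/-- `(u wᵀ).map σ = (σ∘u)(σ∘w)ᵀ` (a ring hom is multiplicative). [cite: HornJohnson2013, §0.4.6] -/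
theorem map_vecMulVec (u w : Fin 3 → E) : (vecMulVec u w).map σ = vecMulVec (σ ∘ u) (σ ∘ w) := by
  ext i j
  simp [Matrix.vecMulVec_apply]

/-- `c • u·ᵗ(σu)·J₃` lies in `𝔲(J₃)` whenever `σ c = −c`. [cite: Rogawski1990, §1.9 p. 8] -/
theorem smul_vecMulVec_form_mem (hσ : ∀ x, σ (σ x) = x) (u : Fin 3 → E) {c : E} (hc : σ c = -c) :
    ((c • vecMulVec u (vecMul (σ ∘ u) !![(0 : E), 0, 1; 0, 1, 0; 1, 0, 0])).map σ)ᵀ * !![(0 : E), 0, 1; 0, 1, 0; 1, 0, 0] +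
        !![(0 : E), 0, 1; 0, 1, 0; 1, 0, 0] * (c • vecMulVec u (vecMul (σ ∘ u) !![(0 : E), 0, 1; 0, 1, 0; 1, 0, 0])) = 0 := by
  have hq : σ ∘ (vecMul (σ ∘ u) !![(0 : E), 0, 1; 0, 1, 0; 1, 0, 0]) = !![(0 : E), 0, 1; 0, 1, 0; 1, 0, 0] *ᵥ u :=
    funext fun i => sigma_vecMul_antidiagonal_three σ hσ u i
  have hsm : (c • vecMulVec u (vecMul (σ ∘ u) !![(0 : E), 0, 1; 0, 1, 0; 1, 0, 0])).map σ =
      σ c • (vecMulVec u (vecMul (σ ∘ u) !![(0 : E), 0, 1; 0, 1, 0; 1, 0, 0])).map σ := by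
    ext i j
    simp
  rw [hsm, map_vecMulVec, hq, Matrix.transpose_smul, Matrix.transpose_vecMulVec, Matrix.smul_mul, Matrix.vecMulVec_mul,
    Matrix.mul_smul, Matrix.mul_vecMulVec, ← add_smul, hc, neg_add_cancel, zero_smul]

/-- **Structure of square-zero elements**: `X ∈ 𝔲(J₃)`, `X ≠ 0`, `X² = 0` ⇒ `X = c • u·ᵗ(σu)·J₃` with `u ≠ 0` ISOTROPIC (`ᵗ(σu) J₃ u = 0`), `c ≠ 0`, `σ c = −c`.
[cite: HornJohnson2013, §0.4.6] [cite: Rogawski1990, §1.9 p. 8] -/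
theorem exists_eq_smul_vecMulVec_of_mem (hσ : ∀ x, σ (σ x) = x) {X : Matrix (Fin 3) (Fin 3) E}
    (hX : (X.map σ)ᵀ * !![(0 : E), 0, 1; 0, 1, 0; 1, 0, 0] + !![(0 : E), 0, 1; 0, 1, 0; 1, 0, 0] * X = 0) (h0 : X ≠ 0) (h2 : X * X = 0) :
    ∃ (u : Fin 3 → E) (c : E), u ≠ 0 ∧ c ≠ 0 ∧ σ c = -c ∧ vecMul (σ ∘ u) !![(0 : E), 0, 1; 0, 1, 0; 1, 0, 0] ⬝ᵥ u = 0 ∧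
      X = c • vecMulVec u (vecMul (σ ∘ u) !![(0 : E), 0, 1; 0, 1, 0; 1, 0, 0]) := by
  obtain ⟨u, w, hu, hw, rfl, hwu⟩ := exists_vecMulVec_of_mul_self_eq_zero h0 h2
  -- names (local abbreviations, no definitions): `q = ᵗ(σu) J₃`, `Ju = J₃ u`
  set q : Fin 3 → E := vecMul (σ ∘ u) !![(0 : E), 0, 1; 0, 1, 0; 1, 0, 0] with hqdef
  set Ju : Fin 3 → E := !![(0 : E), 0, 1; 0, 1, 0; 1, 0, 0] *ᵥ u with hJudef
  have hq : σ ∘ q = Ju := funext fun i => sigma_vecMul_antidiagonal_three σ hσ u i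
  -- the `𝔲`-condition entrywise: `σ (w i) * q j + Ju i * w j = 0`
  rw [map_vecMulVec, Matrix.transpose_vecMulVec, Matrix.vecMulVec_mul, Matrix.mul_vecMulVec] at hX
  have hent : ∀ i j, σ (w i) * q j + Ju i * w j = 0 := fun i j => by
    have e := congrFun (congrFun hX i) j
    simpa only [Matrix.add_apply, Matrix.vecMulVec_apply, Matrix.zero_apply, Function.comp_apply] using e
  -- `Ju ≠ 0` (as `J₃² = 1`) and `w ≠ 0`: pick witnesses
  have hJu : Ju ≠ 0 := by
    intro h0'
    apply hu
    have e : !![(0 : E), 0, 1; 0, 1, 0; 1, 0, 0] *ᵥ Ju = u := by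
      rw [hJudef, Matrix.mulVec_mulVec, antidiagonal_three_mul_self, Matrix.one_mulVec]
    rw [← e, h0', Matrix.mulVec_zero]
  obtain ⟨i₀, hi₀⟩ := Function.ne_iff.mp hJu
  obtain ⟨j₀, hj₀⟩ := Function.ne_iff.mp hw
  replace hi₀ : Ju i₀ ≠ 0 := by simpa using hi₀
  replace hj₀ : w j₀ ≠ 0 := by simpa using hj₀
  -- `w = c • q` with `c = −σ(w i₀) ∕ Ju i₀`
  set c : E := -(σ (w i₀)) * (Ju i₀)⁻¹ with hcdef
  have hwc : w = c • q := by
    funext j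
    have e : Ju i₀ * w j = -(σ (w i₀) * q j) := by linear_combination hent i₀ j
    rw [Pi.smul_apply, smul_eq_mul, hcdef]
    calc w j = (Ju i₀)⁻¹ * (Ju i₀ * w j) := by rw [← mul_assoc, inv_mul_cancel₀ hi₀, one_mul]
      _ = -σ (w i₀) * (Ju i₀)⁻¹ * q j := by rw [e]; ring
  have hc0 : c ≠ 0 := by
    intro hc
    apply hw
    rw [hwc, hc, zero_smul]
  have hqj₀ : q j₀ ≠ 0 := by
    intro hq0
    apply hj₀
    rw [hwc, Pi.smul_apply, smul_eq_mul, hq0, mul_zero]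
  -- `σ c = −c` from the `(i₀, j₀)` equation and `σ (q i) = Ju i`
  have hσq : σ (q i₀) = Ju i₀ := congrFun hq i₀
  have hσc : σ c = -c := by
    have e := hent i₀ j₀
    rw [hwc, Pi.smul_apply, Pi.smul_apply, smul_eq_mul, smul_eq_mul, map_mul, hσq] at e
    -- `e : σ c * Ju i₀ * q j₀ + Ju i₀ * (c * q j₀) = 0`
    have e' : (σ c + c) * (Ju i₀ * q j₀) = 0 := by linear_combination e
    rcases mul_eq_zero.mp e' with h | h
    · exact eq_neg_of_add_eq_zero_left h
    · exact absurd h (mul_ne_zero hi₀ hqj₀)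
  -- isotropy from `w ⬝ᵥ u = 0`
  have hiso : q ⬝ᵥ u = 0 := by
    rw [hwc, smul_dotProduct, smul_eq_mul] at hwu
    exact (mul_eq_zero.mp hwu).resolve_left hc0
  refine ⟨u, c, hu, hc0, hσc, hiso, ?_⟩
  rw [hwc, Matrix.vecMulVec_smul]

/-! ## §4 Witt: a non-zero isotropic vector is the first column of a unitary matrix -/

/-- **WITT (explicit Bruhat form)**: for a non-zero ISOTROPIC `u` there is a unitary `g` with first column `u`
(`g = diag(u₀, 1, (σu₀)⁻¹)` if `u₂ = 0`; `g = n(u₀∕u₂, ·) · J₃ · diag(u₂, 1, (σu₂)⁻¹)` otherwise). [cite: Rogawski1990, §1.9 p. 8] -/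
theorem exists_unitary_col_zero_eq (hσ : ∀ x, σ (σ x) = x) {u : Fin 3 → E} (hu : u ≠ 0)
    (hiso : vecMul (σ ∘ u) !![(0 : E), 0, 1; 0, 1, 0; 1, 0, 0] ⬝ᵥ u = 0) :
    ∃ g : Matrix (Fin 3) (Fin 3) E, (g.map σ)ᵀ * !![(0 : E), 0, 1; 0, 1, 0; 1, 0, 0] * g = !![(0 : E), 0, 1; 0, 1, 0; 1, 0, 0] ∧
      (fun i => g i 0) = u := by
  have hform := form_apply σ u u
  rw [hiso] at hform
  -- `hform : 0 = σ u₀ u₂ + σ u₁ u₁ + σ u₂ u₀`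
  by_cases h2 : u 2 = 0
  · -- `u = u₀ e₀`: then `σ u₁ · u₁ = 0`, so `u₁ = 0`, and `u₀ ≠ 0`
    have h1 : u 1 = 0 := by
      rw [h2, map_zero] at hform
      have : σ (u 1) * u 1 = 0 := by linear_combination -hform
      rcases mul_eq_zero.mp this with h | h
      · exact (map_eq_zero σ).mp h
      · exact h
    have h0 : u 0 ≠ 0 := by
      intro h0
      apply hu
      funext i
      fin_cases i
      · exact h0
      · exact h1
      · exact h2
    refine ⟨diagonal ![u 0, 1, (σ (u 0))⁻¹], diagonal_unitary σ hσ h0 (by rw [map_one, one_mul]), ?_⟩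
    funext i
    fin_cases i
    · simp
    · simp [h1]
    · simp [h2]
  · -- Bruhat element `n(x,y) · J₃ · diag(u₂, 1, (σu₂)⁻¹)` with `y = u₀∕u₂`, `x = −σ u₁ ∕ σ u₂`
    have hσ2 : σ (u 2) ≠ 0 := (map_ne_zero σ).mpr h2
    set x : E := -(σ (u 1) * (σ (u 2))⁻¹) with hx
    set y : E := u 0 * (u 2)⁻¹ with hy
    have hxy : y + σ y + x * σ x = 0 := by
      rw [hy, hx, map_mul, map_inv₀, map_neg, map_mul, map_inv₀, hσ, hσ]
      field_simp
      linear_combination -hform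
    refine ⟨!![(1 : E), x, y; 0, 1, -σ x; 0, 0, 1] * !![(0 : E), 0, 1; 0, 1, 0; 1, 0, 0] * diagonal ![u 2, 1, (σ (u 2))⁻¹],
      unitary_mul σ (unitary_mul σ (heisenberg_unitary σ hσ hxy) (antidiagonal_three_unitary σ))
        (diagonal_unitary σ hσ h2 (by rw [map_one, one_mul])), ?_⟩
    funext i
    fin_cases i
    · simp [Matrix.mul_apply, Fin.sum_univ_three, hy, h2]
    · simp [Matrix.mul_apply, Fin.sum_univ_three, hx, map_neg, map_mul, map_inv₀, hσ, h2]
    · simp [Matrix.mul_apply, Fin.sum_univ_three]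

/-- Conjugating the model: for unitary `g`, `g (c·E₀₂) g⁻¹ = c • (g e₀)·ᵗ(σ(g e₀))·J₃`. [cite: Rogawski1990, §1.9 p. 8] -/
theorem unitary_conj_single_zero_two {g : Matrix (Fin 3) (Fin 3) E}
    (hg : (g.map σ)ᵀ * !![(0 : E), 0, 1; 0, 1, 0; 1, 0, 0] * g = !![(0 : E), 0, 1; 0, 1, 0; 1, 0, 0]) (c : E) :
    g * single (0 : Fin 3) (2 : Fin 3) c * g⁻¹ = c • vecMulVec (fun i => g i 0) (vecMul (σ ∘ fun i => g i 0) !![(0 : E), 0, 1; 0, 1, 0; 1, 0, 0]) := by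
  rw [inv_eq_of_unitary σ hg]
  -- `g (c E₀₂) = (g e₀)(c e₂)ᵀ` and `(c e₂)ᵀ J (g.map σ)ᵀ J = c ᵗ(σ(g e₀)) J`
  have h1 : g * single (0 : Fin 3) (2 : Fin 3) c = vecMulVec (fun i => g i 0) (Pi.single (2 : Fin 3) c) := by
    ext i j
    fin_cases j <;> simp [Matrix.mul_apply, Fin.sum_univ_three, Matrix.vecMulVec_apply]
  have h2 : Pi.single (2 : Fin 3) c ᵥ* (!![(0 : E), 0, 1; 0, 1, 0; 1, 0, 0] * (g.map σ)ᵀ * !![(0 : E), 0, 1; 0, 1, 0; 1, 0, 0]) =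
      c • vecMul (σ ∘ fun i => g i 0) !![(0 : E), 0, 1; 0, 1, 0; 1, 0, 0] := by
    funext j
    simp only [Matrix.vecMul, dotProduct, Fin.sum_univ_three, Matrix.mul_apply, Matrix.transpose_apply, Matrix.map_apply, Pi.smul_apply,
      smul_eq_mul, Function.comp_apply]
    fin_cases j <;> simp
  rw [show g * single (0 : Fin 3) (2 : Fin 3) c * (!![(0 : E), 0, 1; 0, 1, 0; 1, 0, 0] * (g.map σ)ᵀ * !![(0 : E), 0, 1; 0, 1, 0; 1, 0, 0]) =
      (g * single (0 : Fin 3) (2 : Fin 3) c) * (!![(0 : E), 0, 1; 0, 1, 0; 1, 0, 0] * (g.map σ)ᵀ * !![(0 : E), 0, 1; 0, 1, 0; 1, 0, 0]) by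
      simp only [Matrix.mul_assoc], h1, Matrix.vecMulVec_mul, h2, Matrix.vecMulVec_smul]

/-! ## §5 Every minimal nilpotent of `𝔲(J₃)` is unitarily conjugate to the model `c·E₀₂` -/

/-- **MAIN**: `X ∈ 𝔲(J₃)`, `X ≠ 0`, `X² = 0` ⇒ `X = g (c·E₀₂) g⁻¹` for a unitary `g` and a non-zero `c` with `σ c = −c`.
[cite: Rogawski1990, §1.9 p. 8] [cite: HornJohnson2013, §0.4.6] -/
theorem exists_unitary_conj_single_zero_two (hσ : ∀ x, σ (σ x) = x) {X : Matrix (Fin 3) (Fin 3) E}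
    (hX : (X.map σ)ᵀ * !![(0 : E), 0, 1; 0, 1, 0; 1, 0, 0] + !![(0 : E), 0, 1; 0, 1, 0; 1, 0, 0] * X = 0) (h0 : X ≠ 0) (h2 : X * X = 0) :
    ∃ (g : Matrix (Fin 3) (Fin 3) E) (c : E), (g.map σ)ᵀ * !![(0 : E), 0, 1; 0, 1, 0; 1, 0, 0] * g = !![(0 : E), 0, 1; 0, 1, 0; 1, 0, 0] ∧
      σ c = -c ∧ c ≠ 0 ∧ X = g * single (0 : Fin 3) (2 : Fin 3) c * g⁻¹ := by
  obtain ⟨u, c, hu, hc0, hσc, hiso, rfl⟩ := exists_eq_smul_vecMulVec_of_mem σ hσ hX h0 h2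
  obtain ⟨g, hg, hcol⟩ := exists_unitary_col_zero_eq σ hσ hu hiso
  refine ⟨g, c, hg, hσc, hc0, ?_⟩
  rw [unitary_conj_single_zero_two σ hg c, hcol]

end Literature.LinearAlgebra.Matrix.UnitaryThreeWitt
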